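import Mathlib.Analysis.Calculus.Deriv.MeanValue
import Literature.MathematicalPhysics.QuantumFieldTheory.Balaban1983to89.T4ShellMeasure
import Summits.QuantumFields.YangMills.Theorems.BalabanUVNodesN21GaussianSupDensityBoundHetero

/-!
# N21 (NE7c) · (M1) for a BLOCK-SUP statistic from CONDITIONAL hazard bounds, uniformly in the number of tested
# variables and WITHOUT independence — the first-exceedance decomposition

R134 seat pub-ymgap-dag-n21-d (g8), node N21 = NE7c (single-run shell-weight bound, NOT PRINTED in [Bałaban 1983–89],
NOT proved), lane K3⁷ `SpineGivenEndpointR13SepCoPH` (stmt-QuantumFields-20544, `--kind proof --supports … --as helper`).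
Part 7 of the comparison series (parts 1–6: `…N21GaussianMillsRatio`, `…N21GaussianSupDensityBound`,
`…N21GaussianSupDensityBoundHetero`, `…N21GaussianTailRatio`, `…N21GaussianTailRatioUpper`, `…N21MaxHazardRate`).

WHAT THIS FILE IS.  Part 6 showed, for INDEPENDENT variables with densities, that the density of a maximum never exceeds a
common HAZARD-RATE bound of its components, whatever their number.  This file removes both the independence and the
densities.  Let `ν` be ANY measure on `Ω` and `v p : Ω → ℝ`, `p ∈ ι` (finite), ANY measurable tested variables; write
`a = θ(1 − ρ)`, `b = θ`.  The shell event of the block-sup `x ↦ ⨆ p, v p x` is `{∀ q, v q < b} ∖ {∀ q, v q < a}`;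
lowering the thresholds from `b` to `a` ONE VARIABLE AT A TIME telescopes it into slices
`{a ≤ v p < b} ∩ C(p, s)`, where `C(p, s) = {v q < a for q ∈ s, v q < b for q ∉ s, q ≠ p}` is a SUB-LEVEL EVENT OF THE
OTHER VARIABLES (§1).  If every variable obeys the CONDITIONAL WINDOWED HAZARD BOUND
`ν({a ≤ v p < b} ∩ C) ≤ c · ν({a ≤ v p} ∩ C)` at these sub-level events `C` (the shell of `v p` is a `c`-fraction of
its own exceedance event, GIVEN that the other variables sit below the stated levels), then the events `{a ≤ v p} ∩ C(p, s)`
— «`p` is the FIRST variable to reach `a`» — are pairwise disjoint, and summing gives (§2)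

  `ν{a ≤ ⨆ v < b} ≤ c · ν{a ≤ ⨆ v}`  — the SAME constant `c`, WHATEVER THE NUMBER of variables, NO independence, and
  RELATIVE TO THE SLOT'S OWN FIRING EVENT `{a ≤ ⨆ v}`;

in the tree's (M1) currency: `T4ShellMeasure.SlotAntiConcentration ν (⨆ v) θ ρ D` from the conditional bounds with
constant `ofReal(D·ρ)` (`slotAntiConcentration_iSup_of_condHazard`) — against the union bound's `Σ_p D_p` (lens memo
`ym-lens-BalabanUVNodes-nearmiss` Sketch-g12 §M (M-b), near-miss N60).  §3: for PRODUCT laws `Measure.pi μ` the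
conditional bound IS the one-dimensional windowed hazard bound `μ p [a, b) ≤ c · μ p [a, ∞)` (boxes factorise), for
arbitrary, non-identical laws `μ p`.  §4: the standard Gaussian obeys it with `c = (b⁺ + 4)(b − a)` (part 3's uniform
Mills bound `φ ≤ (w⁺ + 4)(1 − Φ)` + part 1's `Φ′ = φ`, CITED BY NAME, and the mean value theorem on `[a, b]`), so §3
RE-PROVES part 2's (M1) for the max of independent standard Gaussians with the `n`-FREE constant `(θ + 4)·θ` in place of
`(√(2 log n) + 4)·θ`, and in the sharper relative form `≤ (θ + 4)θρ · P(max ≥ θ(1 − ρ))`; §5 does the same for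
UNEQUAL variances `N(0, v_p)`, `v_p ≥ v_min > 0`: constant `(θ∕√v_min + 4)·θ∕√v_min`, reading the smallest variance
only — part 3's `√(v_max∕v_min)·√(2 log n)` is gone.

READING FOR THE WALL (lens Card 36 ∕ KT-36a, part 6's header continued).  On the true (2.18) fibre law nothing is
independent; what §2 isolates is the exact per-plaquette input that makes the block-sup's (M1) constant level-uniform:
a windowed hazard bound of ONE tested plaquette variable CONDITIONAL on sub-level events of the others — a
one-dimensional, large-deviation-type quantity («how much of the event "this plaquette reaches `θ(1−ρ)` while the named
others stay small" lies in the thin shell below `θ`»).  Whether Bałaban's measure supplies it is NOT claimed here.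

HONEST FRAMING.  [textbook] measure theory on a finite index set (the first-exceedance ∕ competing-risks identity) and
one Gaussian computation; 0 def, 0 sorry; nothing of Bałaban's asserted; NE7c NOT PRINTED ∕ NOT proved; N21 NOT
discharged; counts unmoved (typed 28∕28 · discharged 5∕27); count-neutral; one finite 𝕋⁴ at fixed ε — nothing about
ℝ⁴ ∕ OS ∕ mass gap ∕ Clay.
-/

open MeasureTheory Set
open scoped ENNReal NNReal

namespace Summit.QuantumFields.YangMills.Theorems.N21FirstExceedanceHazard

open Literature.MathematicalPhysics.QuantumFieldTheory.Balaban1983to89.T4ShellMeasure (SlotAntiConcentration)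

/-! ## §1–§2 The first-exceedance decomposition and the dependent hazard principle -/

section Core

variable {Ω ι : Type*} [MeasurableSpace Ω] [DecidableEq ι] (ν : Measure Ω) (v : ι → Ω → ℝ) (a b : ℝ)

/-- **THE INDUCTIVE CORE (lowering the thresholds one variable at a time).**  For a finite set `s` of indices let
`E(s) = {∀ q, v q < (a if q ∈ s, b otherwise)}` be the SUB-LEVEL event «the variables in `s` are below `a`, the others
below `b`».  Under the conditional windowed hazard bound at the sub-level events of the other variables
(`ν({a ≤ v p < b} ∩ C(p, s)) ≤ c · ν({a ≤ v p} ∩ C(p, s))` for `p ∉ s`), one has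
`ν(E(∅) ∖ E(s)) ≤ c · ν(⋃_{q ∈ s} {a ≤ v q})` for EVERY `s` — by induction on `s`: the new slice `E(s) ∖ E(insert p s)`
is the hazard slice of `p` at `C(p, s)`, and the first-exceedance events `{a ≤ v p} ∩ C(p, s)` and `⋃_{q∈s}{a ≤ v q}` are
DISJOINT (on `C(p, s)` every `q ∈ s` has `v q < a`).  No sign or order condition on `a, b, c`. [textbook] -/
theorem measure_sdiff_subLevel_le_of_condHazard (hv : ∀ p, Measurable (v p)) (c : ℝ≥0∞)
    (hhaz : ∀ p (s : Finset ι), p ∉ s →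
      ν ({x | a ≤ v p x ∧ v p x < b} ∩ {x | ∀ q, q ≠ p → v q x < if q ∈ s then a else b})
        ≤ c * ν ({x | a ≤ v p x} ∩ {x | ∀ q, q ≠ p → v q x < if q ∈ s then a else b}))
    (s : Finset ι) :
    ν ({x | ∀ q, v q x < b} \ {x | ∀ q, v q x < if q ∈ s then a else b})
      ≤ c * ν (⋃ q ∈ s, {x | a ≤ v q x}) := by
  induction s using Finset.induction_on with
  | empty =>
    have h0 : ({x | ∀ q, v q x < b} \ {x : Ω | ∀ q, v q x < if q ∈ (∅ : Finset ι) then a else b}) = ∅ := by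
      ext x
      simp only [Finset.notMem_empty, if_false, mem_sdiff, mem_setOf_eq, mem_empty_iff_false, iff_false, not_and,
        not_not]
      exact fun h => h
    rw [h0, measure_empty]
    exact bot_le
  | insert p s hp ih =>
    -- names for the five events
    set E0 : Set Ω := {x | ∀ q, v q x < b} with hE0
    set Es : Set Ω := {x | ∀ q, v q x < if q ∈ s then a else b} with hEs
    set Eps : Set Ω := {x | ∀ q, v q x < if q ∈ insert p s then a else b} with hEps
    set C : Set Ω := {x | ∀ q, q ≠ p → v q x < if q ∈ s then a else b} with hC
    set Gs : Set Ω := ⋃ q ∈ s, {x | a ≤ v q x} with hGs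
    have hGs_meas : MeasurableSet Gs :=
      Finset.measurableSet_biUnion s fun q _ => measurableSet_le measurable_const (hv q)
    have hkey : ∀ q, q ≠ p → ((if q ∈ insert p s then a else b) = if q ∈ s then a else b) := fun q hq => by
      simp only [Finset.mem_insert, hq, false_or]
    -- (1) the new slice is the hazard slice of `p` at the sub-level event `C(p, s)`
    have hslice : Es \ Eps ⊆ {x | a ≤ v p x ∧ v p x < b} ∩ C := by
      rintro x ⟨hxs, hxps⟩
      simp only [hEs, hEps, mem_setOf_eq, not_forall, not_lt] at hxs hxps
      obtain ⟨q, hq⟩ := hxps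
      have hqp : q = p := by
        by_contra hne
        rw [hkey q hne] at hq
        exact absurd (hxs q) (not_lt.2 hq)
      rw [hqp] at hq
      simp only [Finset.mem_insert_self, if_true] at hq
      have hpb : v p x < b := by
        have := hxs p
        rwa [if_neg hp] at this
      exact ⟨⟨hq, hpb⟩, fun q' _ => hxs q'⟩
    -- (2) splitting off the new slice
    have hsplit : E0 \ Eps ⊆ (E0 \ Es) ∪ (Es \ Eps) := by
      rintro x ⟨h0, hn⟩
      by_cases hx : x ∈ Es
      · exact Or.inr ⟨hx, hn⟩
      · exact Or.inl ⟨h0, hx⟩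
    -- (3) the first-exceedance events are disjoint …
    have hdisj : Disjoint Gs ({x | a ≤ v p x} ∩ C) := by
      rw [Set.disjoint_left]
      rintro x hx ⟨-, hx'⟩
      simp only [hGs, mem_iUnion, mem_setOf_eq, exists_prop] at hx
      obtain ⟨q, hqs, hq⟩ := hx
      have hne : q ≠ p := fun h => hp (h ▸ hqs)
      have := hx' q hne
      rw [if_pos hqs] at this
      exact absurd this (not_lt.2 hq)
    -- … and exhaust the exceedance event of `insert p s`
    have hGsub : Gs ∪ ({x | a ≤ v p x} ∩ C) ⊆ ⋃ q ∈ insert p s, {x | a ≤ v q x} := by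
      rintro x (hx | ⟨hx, -⟩)
      · simp only [hGs, mem_iUnion, mem_setOf_eq, exists_prop] at hx ⊢
        obtain ⟨q, hqs, hq⟩ := hx
        exact ⟨q, Finset.mem_insert_of_mem hqs, hq⟩
      · simp only [mem_iUnion, mem_setOf_eq, exists_prop]
        exact ⟨p, Finset.mem_insert_self p s, hx⟩
    calc ν (E0 \ Eps) ≤ ν ((E0 \ Es) ∪ (Es \ Eps)) := measure_mono hsplit
      _ ≤ ν (E0 \ Es) + ν (Es \ Eps) := measure_union_le _ _
      _ ≤ c * ν Gs + c * ν ({x | a ≤ v p x} ∩ C) :=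
          add_le_add ih ((measure_mono hslice).trans (hhaz p s hp))
      _ = c * ν (Gs ∪ ({x | a ≤ v p x} ∩ C)) := by rw [measure_union' hdisj hGs_meas, mul_add]
      _ ≤ c * ν (⋃ q ∈ insert p s, {x | a ≤ v q x}) := mul_le_mul_right (measure_mono hGsub) _

variable [Fintype ι] [Nonempty ι]

omit [MeasurableSpace Ω] [DecidableEq ι] in
/-- the shell event of the block-sup is the difference of two sub-level events:
`{a ≤ ⨆ v < b} = {∀ q, v q < b} ∖ {∀ q, v q < a}` (finite nonempty index: the sup is attained). [folklore] -/
theorem setOf_shell_iSup_eq_sdiff :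
    {x | a ≤ (⨆ p, v p x) ∧ (⨆ p, v p x) < b} = {x | ∀ q, v q x < b} \ {x | ∀ q, v q x < a} := by
  ext x
  have hbdd : BddAbove (Set.range fun p => v p x) := (Set.finite_range _).bddAbove
  obtain ⟨p₀, hp₀⟩ := exists_eq_ciSup_of_finite (f := fun p => v p x)
  simp only [mem_setOf_eq, mem_sdiff, not_forall, not_lt]
  constructor
  · rintro ⟨ha, hb⟩
    exact ⟨fun q => (le_ciSup hbdd q).trans_lt hb, p₀, by rw [hp₀]; exact ha⟩
  · rintro ⟨hb, q, hq⟩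
    refine ⟨hq.trans (le_ciSup hbdd q), ?_⟩
    rw [← hp₀]
    exact hb p₀

omit [MeasurableSpace Ω] [DecidableEq ι] in
/-- the exceedance event of the block-sup is the union of the exceedance events: `{a ≤ ⨆ v} = ⋃_q {a ≤ v q}`. [folklore] -/
theorem setOf_le_iSup_eq_iUnion :
    {x | a ≤ ⨆ p, v p x} = ⋃ q, {x | a ≤ v q x} := by
  ext x
  have hbdd : BddAbove (Set.range fun p => v p x) := (Set.finite_range _).bddAbove
  obtain ⟨p₀, hp₀⟩ := exists_eq_ciSup_of_finite (f := fun p => v p x)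
  simp only [mem_setOf_eq, mem_iUnion]
  constructor
  · intro h
    exact ⟨p₀, by rw [hp₀]; exact h⟩
  · rintro ⟨q, hq⟩
    exact hq.trans (le_ciSup hbdd q)

/-- **THE DEPENDENT HAZARD PRINCIPLE.**  For ANY measure `ν` and ANY finite nonempty family of measurable tested
variables `v p`: if each `v p` obeys the conditional windowed hazard bound
`ν({a ≤ v p < b} ∩ C) ≤ c · ν({a ≤ v p} ∩ C)` at the sub-level events `C = {v q < a on s, v q < b off s, q ≠ p}` of
the OTHER variables, then the shell of the block-sup is a `c`-fraction OF ITS OWN EXCEEDANCE EVENT: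
`ν{a ≤ ⨆ v < b} ≤ c · ν{a ≤ ⨆ v}` — the same `c`, whatever the number of variables, no independence, no density.
[textbook] -/
theorem measure_shell_iSup_le_of_condHazard (hv : ∀ p, Measurable (v p)) (c : ℝ≥0∞)
    (hhaz : ∀ p (s : Finset ι), p ∉ s →
      ν ({x | a ≤ v p x ∧ v p x < b} ∩ {x | ∀ q, q ≠ p → v q x < if q ∈ s then a else b})
        ≤ c * ν ({x | a ≤ v p x} ∩ {x | ∀ q, q ≠ p → v q x < if q ∈ s then a else b})) :
    ν {x | a ≤ (⨆ p, v p x) ∧ (⨆ p, v p x) < b} ≤ c * ν {x | a ≤ ⨆ p, v p x} := by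
  have h := measure_sdiff_subLevel_le_of_condHazard ν v a b hv c hhaz Finset.univ
  simp only [Finset.mem_univ, if_true, iUnion_true] at h
  rw [setOf_shell_iSup_eq_sdiff, setOf_le_iSup_eq_iUnion]
  exact h

/-- **(M1) FOR THE BLOCK-SUP WITH THE PER-VARIABLE CONSTANT.**  In the tree's currency: conditional windowed hazard
bounds with constant `ofReal(D·ρ)` on the window `[θ(1 − ρ), θ)` for every tested variable give
`T4ShellMeasure.SlotAntiConcentration ν (x ↦ ⨆ p, v p x) θ ρ D` — the SAME `D` as per variable (the union bound of
lens Sketch-g12 §M (M-b) would give `card ι · D`).  No sign conditions. [textbook] -/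
theorem slotAntiConcentration_iSup_of_condHazard (hv : ∀ p, Measurable (v p)) {θ ρ D : ℝ}
    (hhaz : ∀ p (s : Finset ι), p ∉ s →
      ν ({x | θ * (1 - ρ) ≤ v p x ∧ v p x < θ}
          ∩ {x | ∀ q, q ≠ p → v q x < if q ∈ s then θ * (1 - ρ) else θ})
        ≤ ENNReal.ofReal (D * ρ) *
          ν ({x | θ * (1 - ρ) ≤ v p x} ∩ {x | ∀ q, q ≠ p → v q x < if q ∈ s then θ * (1 - ρ) else θ})) :
    SlotAntiConcentration ν (fun x => ⨆ p, v p x) θ ρ D := by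
  unfold SlotAntiConcentration
  exact (measure_shell_iSup_le_of_condHazard ν v _ _ hv _ hhaz).trans
    (mul_le_mul_right (measure_mono (subset_univ _)) _)

end Core

/-! ## §3 Product laws: the conditional bound is the one-dimensional windowed hazard bound -/

section Product

variable {ι : Type*} [Fintype ι] [DecidableEq ι] (μ : ι → Measure ℝ) [∀ i, SigmaFinite (μ i)]

omit [Fintype ι] in
/-- a coordinate event cut by sub-level events of the other coordinates is a box. [folklore] -/
theorem coordSlice_eq_pi (p : ι) (S : Set ℝ) (t : ι → ℝ) :
    ({x : ι → ℝ | x p ∈ S} ∩ {x | ∀ q, q ≠ p → x q < t q})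
      = Set.pi univ (fun q => if q = p then S else Iio (t q)) := by
  ext x
  simp only [mem_inter_iff, mem_setOf_eq, mem_univ_pi]
  constructor
  · rintro ⟨hS, ht⟩ q
    by_cases hq : q = p
    · subst hq
      simpa using hS
    · simpa [hq] using ht q hq
  · intro h
    refine ⟨by simpa using h p, fun q hq => by simpa [hq] using h q⟩

/-- … so under `Measure.pi μ` its mass factorises: `μ p (S) · ∏_{q ≠ p} μ q (−∞, t q)`. [folklore] -/
theorem measure_pi_coordSlice (p : ι) (S : Set ℝ) (t : ι → ℝ) :
    Measure.pi μ ({x : ι → ℝ | x p ∈ S} ∩ {x | ∀ q, q ≠ p → x q < t q})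
      = μ p S * ∏ q ∈ Finset.univ.erase p, μ q (Iio (t q)) := by
  rw [coordSlice_eq_pi, Measure.pi_pi, ← Finset.mul_prod_erase Finset.univ _ (Finset.mem_univ p)]
  simp only [if_true]
  congr 1
  refine Finset.prod_congr rfl fun q hq => ?_
  rw [if_neg (Finset.ne_of_mem_erase hq)]

variable [Nonempty ι]

/-- **THE HAZARD PRINCIPLE FOR PRODUCT LAWS.**  Under `Measure.pi μ` (independent coordinates with ARBITRARY σ-finite
laws `μ p` on `ℝ`), one-dimensional windowed hazard bounds `μ p [a, b) ≤ c · μ p [a, ∞)` for every coordinate give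
`P(a ≤ max < b) ≤ c · P(a ≤ max)` — uniformly in the number of coordinates (§2; the boxes factorise). [textbook] -/
theorem measure_shell_iSup_pi_le_of_hazard {a b : ℝ} (c : ℝ≥0∞) (hhaz : ∀ p, μ p (Ico a b) ≤ c * μ p (Ici a)) :
    Measure.pi μ {x : ι → ℝ | a ≤ (⨆ p, x p) ∧ (⨆ p, x p) < b} ≤ c * Measure.pi μ {x | a ≤ ⨆ p, x p} := by
  refine measure_shell_iSup_le_of_condHazard (Measure.pi μ) (fun p x => x p) a b
    (fun p => measurable_pi_apply p) c fun p s _ => ?_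
  have h1 : ({x : ι → ℝ | a ≤ x p ∧ x p < b} ∩ {x | ∀ q, q ≠ p → x q < if q ∈ s then a else b})
      = {x : ι → ℝ | x p ∈ Ico a b} ∩ {x | ∀ q, q ≠ p → x q < (fun q => if q ∈ s then a else b) q} := rfl
  have h2 : ({x : ι → ℝ | a ≤ x p} ∩ {x | ∀ q, q ≠ p → x q < if q ∈ s then a else b})
      = {x : ι → ℝ | x p ∈ Ici a} ∩ {x | ∀ q, q ≠ p → x q < (fun q => if q ∈ s then a else b) q} := rfl
  rw [h1, h2, measure_pi_coordSlice, measure_pi_coordSlice, ← mul_assoc]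
  exact mul_le_mul_left (hhaz p) _

/-- **(M1) FOR THE MAXIMUM OF INDEPENDENT COORDINATES, `n`-FREE.**  One-dimensional windowed hazard bounds
`μ p [θ(1−ρ), θ) ≤ ofReal(D·ρ) · μ p [θ(1−ρ), ∞)` for every coordinate law give
`T4ShellMeasure.SlotAntiConcentration (Measure.pi μ) (x ↦ ⨆ p, x p) θ ρ D`, whatever `card ι`. [textbook] -/
theorem slotAntiConcentration_iSup_pi_of_hazard {θ ρ D : ℝ}
    (hhaz : ∀ p, μ p (Ico (θ * (1 - ρ)) θ) ≤ ENNReal.ofReal (D * ρ) * μ p (Ici (θ * (1 - ρ)))) :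
    SlotAntiConcentration (Measure.pi μ) (fun x => ⨆ p, x p) θ ρ D := by
  unfold SlotAntiConcentration
  exact (measure_shell_iSup_pi_le_of_hazard μ _ hhaz).trans (mul_le_mul_right (measure_mono (subset_univ _)) _)

end Product

/-! ## §4 The standard Gaussian's windowed hazard bound (parts 1 and 3 by name) and part 2 re-proved `n`-free -/

section Gaussian

open ProbabilityTheory
open Summit.QuantumFields.YangMills.Theorems.N21GaussianMillsRatio (hasDerivAt_cdf_std)
open Summit.QuantumFields.YangMills.Theorems.N21GaussianSupDensityBoundHetero
  (gaussianPDFReal_le_posPart_add_four_mul_tail gaussianReal_var_eq_map)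

/-- **WINDOWED HAZARD BOUND OF `N(0,1)`**: `γ[a, b) ≤ (b⁺ + 4)(b − a) · γ[a, ∞)` for `a ≤ b` — mean value theorem on
`[a, b]` for `Φ` (part 1's `hasDerivAt_cdf_std`) with `Φ′(z) = φ(z) ≤ (z⁺ + 4)(1 − Φ(z)) ≤ (b⁺ + 4)(1 − Φ(a))`
(part 3's `gaussianPDFReal_le_posPart_add_four_mul_tail`, both CITED). [textbook] -/
theorem gaussianReal_Ico_le_hazard_mul_Ici {a b : ℝ} (hab : a ≤ b) :
    gaussianReal 0 1 (Ico a b) ≤ ENNReal.ofReal ((max b 0 + 4) * (b - a)) * gaussianReal 0 1 (Ici a) := by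
  haveI := nullSingletonClass_gaussianReal (μ := (0 : ℝ)) (v := (1 : ℝ≥0)) one_ne_zero
  have hIci : (gaussianReal 0 1).real (Ici a) = 1 - cdf (gaussianReal 0 1) a := by
    rw [measureReal_congr (Ioi_ae_eq_Ici (μ := gaussianReal 0 1) (a := a)).symm, cdf_eq_real,
      ← probReal_compl_eq_one_sub measurableSet_Iic, compl_Iic]
  have hIco : (gaussianReal 0 1).real (Ico a b) = cdf (gaussianReal 0 1) b - cdf (gaussianReal 0 1) a := by
    rw [measureReal_congr (Ico_ae_eq_Ioc (μ := gaussianReal 0 1) (a := a) (b := b)), cdf_eq_real, cdf_eq_real,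
      ← Iic_sdiff_Iic, measureReal_sdiff (Iic_subset_Iic.2 hab) measurableSet_Iic]
  -- the mean value theorem on `[a, b]`
  have hmvt : cdf (gaussianReal 0 1) b - cdf (gaussianReal 0 1) a
      ≤ (max b 0 + 4) * (1 - cdf (gaussianReal 0 1) a) * (b - a) := by
    have hcont : ContinuousOn (fun z => cdf (gaussianReal 0 1) z) (Icc a b) :=
      fun z _ => (hasDerivAt_cdf_std z).continuousAt.continuousWithinAt
    have hdiff : DifferentiableOn ℝ (fun z => cdf (gaussianReal 0 1) z) (interior (Icc a b)) :=
      fun z _ => (hasDerivAt_cdf_std z).differentiableAt.differentiableWithinAt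
    have hbound : ∀ z ∈ interior (Icc a b),
        deriv (fun z => cdf (gaussianReal 0 1) z) z ≤ (max b 0 + 4) * (1 - cdf (gaussianReal 0 1) a) := by
      intro z hz
      rw [interior_Icc, mem_Ioo] at hz
      rw [(hasDerivAt_cdf_std z).deriv]
      have h1 := gaussianPDFReal_le_posPart_add_four_mul_tail z
      have h2 : max z 0 ≤ max b 0 := max_le_max hz.2.le le_rfl
      have h3 : 1 - cdf (gaussianReal 0 1) z ≤ 1 - cdf (gaussianReal 0 1) a := by
        linarith [monotone_cdf (gaussianReal 0 1) hz.1.le]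
      have h4 : 0 ≤ 1 - cdf (gaussianReal 0 1) z := by linarith [cdf_le_one (gaussianReal 0 1) z]
      have h5 : 0 ≤ max b 0 + 4 := by positivity
      calc gaussianPDFReal 0 1 z ≤ (max z 0 + 4) * (1 - cdf (gaussianReal 0 1) z) := h1
        _ ≤ (max b 0 + 4) * (1 - cdf (gaussianReal 0 1) a) := mul_le_mul (by linarith) h3 h4 h5
    exact (convex_Icc a b).image_sub_le_mul_sub_of_deriv_le hcont hdiff hbound a (left_mem_Icc.2 hab) b
      (right_mem_Icc.2 hab) hab
  -- back to `ℝ≥0∞`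
  have hnn1 : 0 ≤ (max b 0 + 4) * (b - a) := mul_nonneg (by positivity) (sub_nonneg.2 hab)
  have hnn2 : 0 ≤ 1 - cdf (gaussianReal 0 1) a := by linarith [cdf_le_one (gaussianReal 0 1) a]
  rw [← ofReal_measureReal (μ := gaussianReal 0 1) (s := Ico a b),
    ← ofReal_measureReal (μ := gaussianReal 0 1) (s := Ici a), hIco, hIci, ← ENNReal.ofReal_mul hnn1]
  refine ENNReal.ofReal_le_ofReal ?_
  calc cdf (gaussianReal 0 1) b - cdf (gaussianReal 0 1) a
      ≤ (max b 0 + 4) * (1 - cdf (gaussianReal 0 1) a) * (b - a) := hmvt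
    _ = (max b 0 + 4) * (b - a) * (1 - cdf (gaussianReal 0 1) a) := by ring

variable {ι : Type*} [Fintype ι] [DecidableEq ι] [Nonempty ι]

/-- **THE MAXIMUM OF INDEPENDENT STANDARD GAUSSIANS, RELATIVE FORM**: for `θ ≥ 0`, `ρ ≥ 0` and ANY finite number of
coordinates, `P(θ(1−ρ) ≤ max < θ) ≤ (θ + 4)·θρ · P(max ≥ θ(1−ρ))` (§3 + the windowed hazard bound at `a = θ(1−ρ)`,
`b = θ`). [textbook] -/
theorem measure_shell_iSup_pi_gaussianReal_le {θ ρ : ℝ} (hθ : 0 ≤ θ) (hρ : 0 ≤ ρ) :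
    Measure.pi (fun _ : ι => gaussianReal 0 1)
        {x : ι → ℝ | θ * (1 - ρ) ≤ (⨆ p, x p) ∧ (⨆ p, x p) < θ}
      ≤ ENNReal.ofReal ((θ + 4) * θ * ρ) *
        Measure.pi (fun _ : ι => gaussianReal 0 1) {x | θ * (1 - ρ) ≤ ⨆ p, x p} := by
  have hab : θ * (1 - ρ) ≤ θ := by nlinarith
  have h := gaussianReal_Ico_le_hazard_mul_Ici hab
  rw [max_eq_left hθ, show (θ + 4) * (θ - θ * (1 - ρ)) = (θ + 4) * θ * ρ by ring] at h
  exact measure_shell_iSup_pi_le_of_hazard (fun _ : ι => gaussianReal 0 1) _ fun _ => h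

/-- **PART 2 RE-PROVED WITH AN `n`-FREE CONSTANT**: `T4ShellMeasure.SlotAntiConcentration` for the maximum coordinate
under `Measure.pi (fun _ : ι => gaussianReal 0 1)` with constant `(θ + 4)·θ` for `θ, ρ ≥ 0` — against part 2's
`(√(2 log n) + 4)·θ` (`slotAntiConcentration_sup'_pi_gaussianReal`): the number of variables never enters once the
bound is taken relative to the exceedance event. [textbook] -/
theorem slotAntiConcentration_iSup_pi_gaussianReal_threshold {θ ρ : ℝ} (hθ : 0 ≤ θ) (hρ : 0 ≤ ρ) :
    SlotAntiConcentration (Measure.pi fun _ : ι => gaussianReal 0 1) (fun x => ⨆ p, x p) θ ρ ((θ + 4) * θ) := by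
  unfold SlotAntiConcentration
  have h := measure_shell_iSup_pi_gaussianReal_le (ι := ι) hθ hρ
  rw [show (θ + 4) * θ * ρ = ((θ + 4) * θ) * ρ by ring] at h
  exact h.trans (mul_le_mul_right (measure_mono (subset_univ _)) _)

/-! ## §5 Rider: unequal variances — part 3 re-proved with neither the number of variables nor `v_max` in the constant -/

/-- windowed hazard bound of `N(0, v)`, `v ≠ 0`: `γ_v[a, b) ≤ (max(b∕√v, 0) + 4)·((b − a)∕√v) · γ_v[a, ∞)` for `a ≤ b`
(§4 transported by part 3's `gaussianReal_var_eq_map`, CITED). [textbook] -/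
theorem gaussianReal_var_Ico_le_hazard_mul_Ici {v : ℝ≥0} (hv : v ≠ 0) {a b : ℝ} (hab : a ≤ b) :
    gaussianReal 0 v (Ico a b)
      ≤ ENNReal.ofReal ((max (b / Real.sqrt v) 0 + 4) * ((b - a) / Real.sqrt v)) * gaussianReal 0 v (Ici a) := by
  have hσ : 0 < Real.sqrt v := Real.sqrt_pos.2 (by exact_mod_cast pos_iff_ne_zero.2 hv)
  rw [gaussianReal_var_eq_map v, Measure.map_apply (measurable_const_mul _) measurableSet_Ico,
    Measure.map_apply (measurable_const_mul _) measurableSet_Ici, preimage_const_mul_Ico₀ _ _ hσ,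
    preimage_const_mul_Ici₀ _ hσ]
  have h := gaussianReal_Ico_le_hazard_mul_Ici (div_le_div_of_nonneg_right hab hσ.le)
  rwa [← sub_div] at h

/-- **THE MAXIMUM OF INDEPENDENT `N(0, v_p)` WITH UNEQUAL VARIANCES**: if `0 < v_min ≤ v p` for every `p`, then for
`θ, ρ ≥ 0` the maximum coordinate under `Measure.pi (p ↦ N(0, v_p))` satisfies `T4ShellMeasure.SlotAntiConcentration`
with constant `(θ∕√v_min + 4)·θ∕√v_min` — it reads the SMALLEST variance only: neither the number of variables nor
`v_max` enters (part 3's constant: `(√(v_max∕v_min)·√(2 log n) + 4)·θ∕√v_min`). [textbook] -/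
theorem slotAntiConcentration_iSup_pi_gaussianReal_var {v : ι → ℝ≥0} {vmin : ℝ} (hvmin : 0 < vmin)
    (hle : ∀ p, vmin ≤ (v p : ℝ)) {θ ρ : ℝ} (hθ : 0 ≤ θ) (hρ : 0 ≤ ρ) :
    SlotAntiConcentration (Measure.pi fun p => gaussianReal 0 (v p)) (fun x => ⨆ p, x p) θ ρ
      ((θ / Real.sqrt vmin + 4) * (θ / Real.sqrt vmin)) := by
  refine slotAntiConcentration_iSup_pi_of_hazard (fun p => gaussianReal 0 (v p)) fun p => ?_
  have hvp : v p ≠ 0 := fun h => by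
    have := hle p
    rw [h, NNReal.coe_zero] at this
    linarith
  have hab : θ * (1 - ρ) ≤ θ := by nlinarith
  refine (gaussianReal_var_Ico_le_hazard_mul_Ici hvp hab).trans (mul_le_mul_left (ENNReal.ofReal_le_ofReal ?_) _)
  have hσp : 0 < Real.sqrt (v p) := Real.sqrt_pos.2 (by exact_mod_cast pos_iff_ne_zero.2 hvp)
  have hσmin : 0 < Real.sqrt vmin := Real.sqrt_pos.2 hvmin
  have hσle : Real.sqrt vmin ≤ Real.sqrt (v p) := Real.sqrt_le_sqrt (hle p)
  have h1 : θ / Real.sqrt (v p) ≤ θ / Real.sqrt vmin := div_le_div_of_nonneg_left hθ hσmin hσle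
  have h0 : 0 ≤ θ / Real.sqrt (v p) := div_nonneg hθ hσp.le
  rw [max_eq_left h0, show θ - θ * (1 - ρ) = θ * ρ by ring, mul_div_right_comm]
  calc (θ / Real.sqrt (v p) + 4) * (θ / Real.sqrt (v p) * ρ)
      ≤ (θ / Real.sqrt vmin + 4) * (θ / Real.sqrt vmin * ρ) :=
        mul_le_mul (by linarith) (mul_le_mul_of_nonneg_right h1 hρ) (by positivity) (by positivity)
    _ = (θ / Real.sqrt vmin + 4) * (θ / Real.sqrt vmin) * ρ := by ring

end Gaussian

end Summit.QuantumFields.YangMills.Theorems.N21FirstExceedanceHazard
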